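import Literature.AnabelianGeometry.EtaleTheta.BiKummerThm44SubModelConnectedBinjWeak
import Literature.AnabelianGeometry.EtaleTheta.BiKummerThm44SubModelConnectedBaseInj

/-!
# [EtTh] Theorem 4.4 (i)(ii)(iii) + `N`-th roots at the GENUINE connected base over the WEAK vocabulary, with the
# binder `hBinj` in BASE-IMAGE form `hBD` (the form of record) — weak twin of `BiKummerThm44SubModelConnectedBaseInj`
# (proof-only)

S. Mochizuki, *The étale theta function and its Frobenioid-theoretic manifestations*, Publ. RIMS **45** (2009)
[MochizukiEtTh2009], §4, Thm 4.4 (i)–(iii), PDF p.94 (printed p.320), proof PDF p.95; Def 3.3 (iii) PDF p.73, Def 3.6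
(i)(ii) PDF pp.76–77.  abc-iut cell, layer L2, plan/L2/SUBDAG-EtTh-Thm44.md (custodian lineage abc-iut-w5-d179), cone
nodes `EtTh:Thm4.4(i)`, `EtTh:Thm4.4(ii)`, `EtTh:Thm4.4(iii)`.  Seat abc-iut-w5-d179 (gen 5).  PROOF-ONLY (0 `def`s, no
`Prop` facts, no instances); nothing landed is edited or restated.

WHY.  abc-iut-L2-t3's v-next census (item A9) records the BASE-IMAGE form

  `hBD : ∀ {A B : D} (α : B ⟶ A), Injective (T.BΛ.map (tf.base.map α).op).hom`

of the Def 3.6 (i) injectivity binder as the form of record (it is what the proofs use, and — unlike the `D₀`-wide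
`hBinj` — it is not falsified by non-connected objects of a typed `D₀`, cf. `BiKummerThm44SubModelConnectedBaseInj.lean`,
p436787, whose §0 `TemperedFrobenioid.…_of_baseInj` lemmas are vocabulary-generic and are consumed here).  The strong
column has p436787; the WEAK column (abc-iut-w6-d037's `BiKummerThm44SubModelConnectedBinjWeak.lean`, p435574, keyed on
`hBinj`) lacked the twin — asked for by abc-iut-L6-t12 (W11 note, 11:11Z).  This file supplies it:

* `Thm44Hyp.preservesFrobeniusStructure_mkOfConnectedTemperoid_of_baseInj_treeVocabWeak` — T44-L03 ⇐ {`hBD₁`, `hBD₂`};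
* `Thm44Hyp.thm44_i_mkOfConnectedTemperoid_of_baseInj_treeVocabWeak` — Thm 4.4 (i) ⇐ {`hBD₁`, `hBD₂`};
* **`Thm44Hyp.thm44_mkOfConnectedTemperoid_of_baseInj_treeVocabWeak(')` — [EtTh] Thm 4.4 (i) ∧ (ii) ∧ (iii)-saturation
  ∧ (`N`-th roots) at `B^temp(Π^tp_X)⁰` over `treeMonoidVocabWeak` ⇐ {`hBD₁`, `hBD₂`, T44-L15b}**;
* **`Thm44Hyp.thm44_mkOfConnectedTemperoid_rootsReading_of_baseInj_treeVocabWeak(')` — at the ROOTS READING of the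
  `(N, H_⊙^{bs-fld})`-slot ⇐ {`hBD₁`, `hBD₂`} and NOTHING ELSE** (abc-iut-w4-d044's V-generic
  `preservesNHSaturatedBsFld_rootsReading`, p431503).
«`D_i` of FSM-type» := [FrdII] Ex 1.3 (i) `connectedPart_isOfFSMType`; «`D_i` slim» := [SemiAnbd] Rmk 3.4.1 / Ex 3.10
`TemperedArithmeticGroup.isSlim_connectedPart`; T44-L09c := abc-iut-w5-d013's `galoisCompatible_mkOfConnectedTemperoid`;
no perf-factorial binder (weak vocabulary of record, plan/FACT-LIST F-L2d2-1); no named fact of plan/FACT-LIST.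

HONEST FRAMING: refereed pre-IUT material ([FrdI]/[FrdII] 2008, [EtTh] 2009, [SemiAnbd] 2006); every theorem is an
implication for data so parametrised; the roots reading is WEAKER than print's cohomological [FrdII] Def 2.2 (ii)(c)
(label carried in the names); nothing here asserts that such data exist for an actual curve or bears on the disputed
[IUTchIII] Cor. 3.12; typed ≠ proved — here PROVED (kernel compositions).
-/

noncomputable section

namespace Literature.AnabelianGeometry.EtaleTheta

open CategoryTheory Opposite Function Literature.AlgebraicGeometry.Frobenioids Literature.AnabelianGeometry.SemiGraphs

universe u₀ v₀ w

namespace BiKummerSetting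

/-! ### §1 [EtTh] Thm 4.4 (i)(ii)(iii) at the genuine connected base, weak vocabulary, from `hBD₁ / hBD₂` -/

section ConnectedWeak

variable {K : Type u₀} [Field K] {K' : Type u₀} [Field K'] {X₁ : SemiGraphs.TemperedArithmeticGroup.{u₀} K}
  {X₂ : SemiGraphs.TemperedArithmeticGroup.{u₀} K'} {D₀ : Type u₀} [Category.{v₀} D₀] {D₀' : Type u₀}
  [Category.{v₀} D₀'] {T₁ : RealifiedDivisorMonoids (D₀ := D₀) treeMonoidVocabWeak.{w}}
  {T₂ : RealifiedDivisorMonoids (D₀ := D₀') treeMonoidVocabWeak.{w}}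
  {IsRational₁ IsStrictlyRational₁ : ((ConnectedPart (BTemp X₁.Pi))ᵒᵖ ⥤ CommMonCat.{w}) → Prop}
  {IsRational₂ IsStrictlyRational₂ : ((ConnectedPart (BTemp X₂.Pi))ᵒᵖ ⥤ CommMonCat.{w}) → Prop}
  (tf₁ : TemperedFrobenioid T₁ (ConnectedPart (BTemp X₁.Pi))
    (treeCatVocab (ConnectedPart (BTemp X₁.Pi)) IsRational₁ IsStrictlyRational₁))
  (hZ₁ : tf₁.monoidType = MonoidType.Z) (hP₁ : ∀ A : (ConnectedPart (BTemp X₁.Pi))ᵒᵖ, IsPerfect (tf₁.Φ.carrier A))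
  (NH₁ : Subgroup (Field.absoluteGaloisGroup K) → tf₁.category → ℕ+ → Prop)
  (A₁ : tf₁.category) (hA₁ : PreFrobenioid.IsFrobeniusTrivial tf₁.toElem A₁)
  (hA₁' : SemiGraphs.IsGaloisObj A₁.base.obj)
  (tf₂ : TemperedFrobenioid T₂ (ConnectedPart (BTemp X₂.Pi))
    (treeCatVocab (ConnectedPart (BTemp X₂.Pi)) IsRational₂ IsStrictlyRational₂))
  (hZ₂ : tf₂.monoidType = MonoidType.Z) (hP₂ : ∀ B : (ConnectedPart (BTemp X₂.Pi))ᵒᵖ, IsPerfect (tf₂.Φ.carrier B))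
  (NH₂ : Subgroup (Field.absoluteGaloisGroup K') → tf₂.category → ℕ+ → Prop)
  (A₂ : tf₂.category) (hA₂ : PreFrobenioid.IsFrobeniusTrivial tf₂.toElem A₂)
  (hA₂' : SemiGraphs.IsGaloisObj A₂.base.obj)

/-- **T44-L03 at the genuine connected base from the base-image binders `hBD₁ / hBD₂` ALONE, WEAK vocabulary**
(`hBmon_i` := p436787's V-generic `isMonoidOn_ratFnFunctor_connectedPart_of_baseInj`, FSM := [FrdII] Ex 1.3 (i)).
[cite: MochizukiEtTh2009, Thm 4.4 p.95] -/
theorem Thm44Hyp.preservesFrobeniusStructure_mkOfConnectedTemperoid_of_baseInj_treeVocabWeak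
    (h : Thm44Hyp (mkOfConnectedTemperoid X₁ tf₁ hZ₁ hP₁ NH₁ A₁ hA₁ hA₁')
      (mkOfConnectedTemperoid X₂ tf₂ hZ₂ hP₂ NH₂ A₂ hA₂ hA₂'))
    (hBD₁ : ∀ {A B : ConnectedPart (BTemp X₁.Pi)} (α : B ⟶ A), Injective (T₁.BΛ.map (tf₁.base.map α).op).hom)
    (hBD₂ : ∀ {A B : ConnectedPart (BTemp X₂.Pi)} (α : B ⟶ A), Injective (T₂.BΛ.map (tf₂.base.map α).op).hom) :
    Thm44Hyp.PreservesFrobeniusStructure (V := treeMonoidVocabWeak.{w}) h :=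
  h.preservesFrobeniusStructure_of_isOfFSMType_treeVocabWeak
    (tf₁.isMonoidOn_ratFnFunctor_connectedPart_of_baseInj hBD₁)
    (tf₂.isMonoidOn_ratFnFunctor_connectedPart_of_baseInj hBD₂)
    QuasiTemperoid.BTempConnected.connectedPart_isOfFSMType QuasiTemperoid.BTempConnected.connectedPart_isOfFSMType

/-- **Thm 4.4 (i) at the genuine connected base from `hBD₁ / hBD₂` ALONE, WEAK vocabulary** (abc-iut-w5-d013's
V-generic `thm44_i_mkOfConnectedTemperoid` with «`C₂` Frobenioid» and T44-L03 supplied from `hBD`).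
[cite: MochizukiEtTh2009, Thm 4.4 (i) p.94] -/
theorem Thm44Hyp.thm44_i_mkOfConnectedTemperoid_of_baseInj_treeVocabWeak
    (h : Thm44Hyp (mkOfConnectedTemperoid X₁ tf₁ hZ₁ hP₁ NH₁ A₁ hA₁ hA₁')
      (mkOfConnectedTemperoid X₂ tf₂ hZ₂ hP₂ NH₂ A₂ hA₂ hA₂'))
    (hBD₁ : ∀ {A B : ConnectedPart (BTemp X₁.Pi)} (α : B ⟶ A), Injective (T₁.BΛ.map (tf₁.base.map α).op).hom)
    (hBD₂ : ∀ {A B : ConnectedPart (BTemp X₂.Pi)} (α : B ⟶ A), Injective (T₂.BΛ.map (tf₂.base.map α).op).hom) :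
    Thm44_i (V := treeMonoidVocabWeak.{w}) h :=
  h.thm44_i_mkOfConnectedTemperoid _ _ _ _ _ _ _ _ _ _ _ _ _ _ (tf₂.isFrobenioid_connectedPart_of_baseInj hBD₂)
    (h.preservesFrobeniusStructure_mkOfConnectedTemperoid_of_baseInj_treeVocabWeak tf₁ hZ₁ hP₁ NH₁ A₁ hA₁ hA₁' tf₂
      hZ₂ hP₂ NH₂ A₂ hA₂ hA₂' hBD₁ hBD₂)

/-- **[EtTh] Thm 4.4 (i) ∧ (ii) ∧ (iii)-saturation ∧ (`N`-th roots) at the genuine connected base `B^temp(Π^tp_X)⁰` over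
the WEAK vocabulary ⇐ {`hBD₁`, `hBD₂` (base-image injectivity of the Def 3.6 (i) datum `B₀^Λ`), T44-L15b}** for
`ψ = psiModel hF₁ hF₂ h3` over ANY proofs (proof-irrelevant; e.g. `isFrobenioid_connectedPart_of_baseInj hBD_i` and
`preservesFrobeniusStructure_…_of_baseInj_treeVocabWeak`): abc-iut-w6-d037's weak `…_of_isOfFSMType_treeVocabWeak`
compositions (p435574) with `hBmon_i := isMonoidOn_ratFnFunctor_connectedPart_of_baseInj hBD_i` — the weak twin of
p436787's `thm44_mkOfConnectedTemperoid_of_baseInj`. [cite: MochizukiEtTh2009, Thm 4.4 p.94] -/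
theorem Thm44Hyp.thm44_mkOfConnectedTemperoid_of_baseInj_treeVocabWeak
    (h : Thm44Hyp (mkOfConnectedTemperoid X₁ tf₁ hZ₁ hP₁ NH₁ A₁ hA₁ hA₁')
      (mkOfConnectedTemperoid X₂ tf₂ hZ₂ hP₂ NH₂ A₂ hA₂ hA₂'))
    (hF₁ : PreFrobenioid.IsFrobenioid tf₁.toElem) (hF₂ : PreFrobenioid.IsFrobenioid tf₂.toElem)
    (h3 : h.PreservesFrobeniusStructure)
    (hBD₁ : ∀ {A B : ConnectedPart (BTemp X₁.Pi)} (α : B ⟶ A), Injective (T₁.BΛ.map (tf₁.base.map α).op).hom)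
    (hBD₂ : ∀ {A B : ConnectedPart (BTemp X₂.Pi)} (α : B ⟶ A), Injective (T₂.BΛ.map (tf₂.base.map α).op).hom)
    (h15 : h.PreservesNHSaturatedBsFld) :
    Thm44_i (V := treeMonoidVocabWeak.{w}) h ∧ Thm44_ii h (h.psiModel hF₁ hF₂ h3) ∧
      Thm44_iii h (h.psiModel hF₁ hF₂ h3) ∧
      h.PreservesNthRoots (h.psiModel hF₁ hF₂ h3) (fun φ f => tf₁.pullFracModel φ f)
        (fun φ f => tf₂.pullFracModel φ f) :=
  ⟨h.thm44_i_mkOfConnectedTemperoid _ _ _ _ _ _ _ _ _ _ _ _ _ _ hF₂ h3,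
    h.thm44_ii_mkOfConnectedTemperoid_of_isFrobenioid_treeVocabWeak hF₁ hF₂ h3,
    h.thm44_iii_of_isOfFSMType_treeVocabWeak _ (tf₁.isMonoidOn_ratFnFunctor_connectedPart_of_baseInj hBD₁)
      (tf₂.isMonoidOn_ratFnFunctor_connectedPart_of_baseInj hBD₂)
      QuasiTemperoid.BTempConnected.connectedPart_isOfFSMType QuasiTemperoid.BTempConnected.connectedPart_isOfFSMType h15,
    h.preservesNthRoots_mkOfModelCanonical_of_isOfFSMType_treeVocabWeak hF₁ hF₂ h3
      (tf₁.isMonoidOn_ratFnFunctor_connectedPart_of_baseInj hBD₁)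
      (tf₂.isMonoidOn_ratFnFunctor_connectedPart_of_baseInj hBD₂)
      QuasiTemperoid.BTempConnected.connectedPart_isOfFSMType QuasiTemperoid.BTempConnected.connectedPart_isOfFSMType
      X₁.isSlim_connectedPart X₂.isSlim_connectedPart
      (h.galoisCompatible_mkOfConnectedTemperoid _ _ _ _ _ _ _ _ _ _ _ _ _ _) h15⟩

/-- **The same with every ψ-slot proof supplied from `hBD`** — literally ⇐ {`hBD₁`, `hBD₂`, T44-L15b}, WEAK vocabulary.
[cite: MochizukiEtTh2009, Thm 4.4 p.94] -/
theorem Thm44Hyp.thm44_mkOfConnectedTemperoid_of_baseInj_treeVocabWeak'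
    (h : Thm44Hyp (mkOfConnectedTemperoid X₁ tf₁ hZ₁ hP₁ NH₁ A₁ hA₁ hA₁')
      (mkOfConnectedTemperoid X₂ tf₂ hZ₂ hP₂ NH₂ A₂ hA₂ hA₂'))
    (hBD₁ : ∀ {A B : ConnectedPart (BTemp X₁.Pi)} (α : B ⟶ A), Injective (T₁.BΛ.map (tf₁.base.map α).op).hom)
    (hBD₂ : ∀ {A B : ConnectedPart (BTemp X₂.Pi)} (α : B ⟶ A), Injective (T₂.BΛ.map (tf₂.base.map α).op).hom)
    (h15 : h.PreservesNHSaturatedBsFld) :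
    Thm44_i (V := treeMonoidVocabWeak.{w}) h ∧
      Thm44_ii h (h.psiModel (tf₁.isFrobenioid_connectedPart_of_baseInj hBD₁)
        (tf₂.isFrobenioid_connectedPart_of_baseInj hBD₂)
        (h.preservesFrobeniusStructure_mkOfConnectedTemperoid_of_baseInj_treeVocabWeak tf₁ hZ₁ hP₁ NH₁ A₁ hA₁ hA₁'
          tf₂ hZ₂ hP₂ NH₂ A₂ hA₂ hA₂' hBD₁ hBD₂)) ∧
      Thm44_iii h (h.psiModel (tf₁.isFrobenioid_connectedPart_of_baseInj hBD₁)
        (tf₂.isFrobenioid_connectedPart_of_baseInj hBD₂)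
        (h.preservesFrobeniusStructure_mkOfConnectedTemperoid_of_baseInj_treeVocabWeak tf₁ hZ₁ hP₁ NH₁ A₁ hA₁ hA₁'
          tf₂ hZ₂ hP₂ NH₂ A₂ hA₂ hA₂' hBD₁ hBD₂)) ∧
      h.PreservesNthRoots (h.psiModel (tf₁.isFrobenioid_connectedPart_of_baseInj hBD₁)
        (tf₂.isFrobenioid_connectedPart_of_baseInj hBD₂)
        (h.preservesFrobeniusStructure_mkOfConnectedTemperoid_of_baseInj_treeVocabWeak tf₁ hZ₁ hP₁ NH₁ A₁ hA₁ hA₁'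
          tf₂ hZ₂ hP₂ NH₂ A₂ hA₂ hA₂' hBD₁ hBD₂))
        (fun φ f => tf₁.pullFracModel φ f) (fun φ f => tf₂.pullFracModel φ f) :=
  Thm44Hyp.thm44_mkOfConnectedTemperoid_of_baseInj_treeVocabWeak tf₁ hZ₁ hP₁ NH₁ A₁ hA₁ hA₁' tf₂ hZ₂ hP₂ NH₂ A₂ hA₂
    hA₂' h _ _ _ hBD₁ hBD₂ h15

end ConnectedWeak

/-! ### §2 At the roots reading of the `(N, H_⊙^{bs-fld})`-slot, weak vocabulary: ⇐ {`hBD₁`, `hBD₂`} only -/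

section ConnectedWeakRoots

variable {K : Type u₀} [Field K] {K' : Type u₀} [Field K'] {X₁ : SemiGraphs.TemperedArithmeticGroup.{u₀} K}
  {X₂ : SemiGraphs.TemperedArithmeticGroup.{u₀} K'} {D₀ : Type u₀} [Category.{v₀} D₀] {D₀' : Type u₀}
  [Category.{v₀} D₀'] {T₁ : RealifiedDivisorMonoids (D₀ := D₀) treeMonoidVocabWeak.{w}}
  {T₂ : RealifiedDivisorMonoids (D₀ := D₀') treeMonoidVocabWeak.{w}}
  {IsRational₁ IsStrictlyRational₁ : ((ConnectedPart (BTemp X₁.Pi))ᵒᵖ ⥤ CommMonCat.{w}) → Prop}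
  {IsRational₂ IsStrictlyRational₂ : ((ConnectedPart (BTemp X₂.Pi))ᵒᵖ ⥤ CommMonCat.{w}) → Prop}
  (tf₁ : TemperedFrobenioid T₁ (ConnectedPart (BTemp X₁.Pi))
    (treeCatVocab (ConnectedPart (BTemp X₁.Pi)) IsRational₁ IsStrictlyRational₁))
  (hZ₁ : tf₁.monoidType = MonoidType.Z) (hP₁ : ∀ A : (ConnectedPart (BTemp X₁.Pi))ᵒᵖ, IsPerfect (tf₁.Φ.carrier A))
  (A₁ : tf₁.category) (hA₁ : PreFrobenioid.IsFrobeniusTrivial tf₁.toElem A₁)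
  (hA₁' : SemiGraphs.IsGaloisObj A₁.base.obj)
  (tf₂ : TemperedFrobenioid T₂ (ConnectedPart (BTemp X₂.Pi))
    (treeCatVocab (ConnectedPart (BTemp X₂.Pi)) IsRational₂ IsStrictlyRational₂))
  (hZ₂ : tf₂.monoidType = MonoidType.Z) (hP₂ : ∀ B : (ConnectedPart (BTemp X₂.Pi))ᵒᵖ, IsPerfect (tf₂.Φ.carrier B))
  (A₂ : tf₂.category) (hA₂ : PreFrobenioid.IsFrobeniusTrivial tf₂.toElem A₂)
  (hA₂' : SemiGraphs.IsGaloisObj A₂.base.obj)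

/-- **[EtTh] Thm 4.4 (i) ∧ (ii) ∧ (iii) ∧ (`N`-th roots) at the genuine connected base over the WEAK vocabulary AT THE
ROOTS READING of the `(N, H_⊙^{bs-fld})`-saturation slot ⇐ {`hBD₁`, `hBD₂`} and NOTHING ELSE** (`ψ = psiModel hF₁ hF₂ h3`,
any proofs): T44-L15b supplied by abc-iut-w4-d044's V-generic `preservesNHSaturatedBsFld_rootsReading` (p431503; HONEST
LABEL: the roots reading is WEAKER than print's cohomological [FrdII] Def 2.2 (ii)(c)). [cite: MochizukiEtTh2009, Thm 4.4 p.94] -/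
theorem Thm44Hyp.thm44_mkOfConnectedTemperoid_rootsReading_of_baseInj_treeVocabWeak
    (h : Thm44Hyp
      (mkOfConnectedTemperoid X₁ tf₁ hZ₁ hP₁
        (fun _ A M => ∀ (g : A.base ⟶ A₁.base) (x : tf₁.ratFnFunctor.obj (op A₁.base)),
          divB tf₁.divisorMonoid tf₁.ratFnFunctor tf₁.divBNatTrans (op A₁.base) x = 1 →
            ∃ ζ : tf₁.ratFnFunctor.obj (op A.base), ζ ^ (M : ℕ) = pull tf₁.ratFnFunctor g x)
        A₁ hA₁ hA₁')
      (mkOfConnectedTemperoid X₂ tf₂ hZ₂ hP₂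
        (fun _ A M => ∀ (g : A.base ⟶ A₂.base) (x : tf₂.ratFnFunctor.obj (op A₂.base)),
          divB tf₂.divisorMonoid tf₂.ratFnFunctor tf₂.divBNatTrans (op A₂.base) x = 1 →
            ∃ ζ : tf₂.ratFnFunctor.obj (op A.base), ζ ^ (M : ℕ) = pull tf₂.ratFnFunctor g x)
        A₂ hA₂ hA₂'))
    (hF₁ : PreFrobenioid.IsFrobenioid tf₁.toElem) (hF₂ : PreFrobenioid.IsFrobenioid tf₂.toElem)
    (h3 : h.PreservesFrobeniusStructure)
    (hBD₁ : ∀ {A B : ConnectedPart (BTemp X₁.Pi)} (α : B ⟶ A), Injective (T₁.BΛ.map (tf₁.base.map α).op).hom)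
    (hBD₂ : ∀ {A B : ConnectedPart (BTemp X₂.Pi)} (α : B ⟶ A), Injective (T₂.BΛ.map (tf₂.base.map α).op).hom) :
    Thm44_i (V := treeMonoidVocabWeak.{w}) h ∧ Thm44_ii h (h.psiModel hF₁ hF₂ h3) ∧
      Thm44_iii h (h.psiModel hF₁ hF₂ h3) ∧
      h.PreservesNthRoots (h.psiModel hF₁ hF₂ h3) (fun φ f => tf₁.pullFracModel φ f)
        (fun φ f => tf₂.pullFracModel φ f) :=
  Thm44Hyp.thm44_mkOfConnectedTemperoid_of_baseInj_treeVocabWeak tf₁ hZ₁ hP₁ _ A₁ hA₁ hA₁' tf₂ hZ₂ hP₂ _ A₂ hA₂ hA₂' h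
    hF₁ hF₂ h3 hBD₁ hBD₂
    (Thm44Hyp.preservesNHSaturatedBsFld_rootsReading tf₁ hZ₁ hP₁ _ _ _ A₁ hA₁ hA₁' tf₂ hZ₂ hP₂ _ _ _ A₂ hA₂ hA₂' h
      hF₁ hF₂ h3)

/-- **The same with every ψ-slot proof supplied from `hBD`** — literally ⇐ {`hBD₁`, `hBD₂`} at the roots reading, WEAK
vocabulary. [cite: MochizukiEtTh2009, Thm 4.4 p.94] -/
theorem Thm44Hyp.thm44_mkOfConnectedTemperoid_rootsReading_of_baseInj_treeVocabWeak'
    (h : Thm44Hyp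
      (mkOfConnectedTemperoid X₁ tf₁ hZ₁ hP₁
        (fun _ A M => ∀ (g : A.base ⟶ A₁.base) (x : tf₁.ratFnFunctor.obj (op A₁.base)),
          divB tf₁.divisorMonoid tf₁.ratFnFunctor tf₁.divBNatTrans (op A₁.base) x = 1 →
            ∃ ζ : tf₁.ratFnFunctor.obj (op A.base), ζ ^ (M : ℕ) = pull tf₁.ratFnFunctor g x)
        A₁ hA₁ hA₁')
      (mkOfConnectedTemperoid X₂ tf₂ hZ₂ hP₂
        (fun _ A M => ∀ (g : A.base ⟶ A₂.base) (x : tf₂.ratFnFunctor.obj (op A₂.base)),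
          divB tf₂.divisorMonoid tf₂.ratFnFunctor tf₂.divBNatTrans (op A₂.base) x = 1 →
            ∃ ζ : tf₂.ratFnFunctor.obj (op A.base), ζ ^ (M : ℕ) = pull tf₂.ratFnFunctor g x)
        A₂ hA₂ hA₂'))
    (hBD₁ : ∀ {A B : ConnectedPart (BTemp X₁.Pi)} (α : B ⟶ A), Injective (T₁.BΛ.map (tf₁.base.map α).op).hom)
    (hBD₂ : ∀ {A B : ConnectedPart (BTemp X₂.Pi)} (α : B ⟶ A), Injective (T₂.BΛ.map (tf₂.base.map α).op).hom) :
    Thm44_i (V := treeMonoidVocabWeak.{w}) h ∧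
      Thm44_ii h (h.psiModel (tf₁.isFrobenioid_connectedPart_of_baseInj hBD₁)
        (tf₂.isFrobenioid_connectedPart_of_baseInj hBD₂)
        (h.preservesFrobeniusStructure_mkOfConnectedTemperoid_of_baseInj_treeVocabWeak tf₁ hZ₁ hP₁ _ A₁ hA₁ hA₁'
          tf₂ hZ₂ hP₂ _ A₂ hA₂ hA₂' hBD₁ hBD₂)) ∧
      Thm44_iii h (h.psiModel (tf₁.isFrobenioid_connectedPart_of_baseInj hBD₁)
        (tf₂.isFrobenioid_connectedPart_of_baseInj hBD₂)
        (h.preservesFrobeniusStructure_mkOfConnectedTemperoid_of_baseInj_treeVocabWeak tf₁ hZ₁ hP₁ _ A₁ hA₁ hA₁'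
          tf₂ hZ₂ hP₂ _ A₂ hA₂ hA₂' hBD₁ hBD₂)) ∧
      h.PreservesNthRoots (h.psiModel (tf₁.isFrobenioid_connectedPart_of_baseInj hBD₁)
        (tf₂.isFrobenioid_connectedPart_of_baseInj hBD₂)
        (h.preservesFrobeniusStructure_mkOfConnectedTemperoid_of_baseInj_treeVocabWeak tf₁ hZ₁ hP₁ _ A₁ hA₁ hA₁'
          tf₂ hZ₂ hP₂ _ A₂ hA₂ hA₂' hBD₁ hBD₂))
        (fun φ f => tf₁.pullFracModel φ f) (fun φ f => tf₂.pullFracModel φ f) :=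
  Thm44Hyp.thm44_mkOfConnectedTemperoid_rootsReading_of_baseInj_treeVocabWeak tf₁ hZ₁ hP₁ A₁ hA₁ hA₁' tf₂ hZ₂ hP₂ A₂
    hA₂ hA₂' h _ _ _ hBD₁ hBD₂

end ConnectedWeakRoots

end BiKummerSetting

end Literature.AnabelianGeometry.EtaleTheta

end
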